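import Mathlib
import Literature.NumberTheory.Transcendental.KZIdealTetrahedron
import Literature.NumberTheory.Transcendental.SemialgebraicMapsProofs

/-!
# `IsometryMove`, line `bruhat-inversion-chain`: the similarity move data

Stub `stub_similarityMove` of the crux `IsometryMove` (stmt-KontsevichZagierPeriods-3471, route
HyperbolicBloch). In the upper half-space `ℝ³` (coordinates `p 0 = x`, `p 1 = y`, `p 2 = t`) a
boundary-fixing similarity
`S(α, β, η) : p ↦ ((α·w + β).re, (α·w + β).im, ‖α‖·p 2)`, `w = p 0 + i·η·p 1` (`η = ±1` is the mirror),
with `α ≠ 0` and `α, β` algebraic over `ℚ`, supplies on every `ℚ`-semialgebraic `σ ⊆ {t > 0}` the four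
data consumed by the one-move transport lemma of the line:

* `S` is a `ℚ`-semialgebraic map on `σ` (its three coordinates are real-affine with real-algebraic
  coefficients `α.re, α.im, β.re, β.im, ‖α‖`, which are `ℚ`-definable constants);
* `S` is injective (indeed globally: cancel `α ≠ 0`, `η ≠ 0`, `‖α‖ ≠ 0`);
* `S` maps `σ` into `{t > 0}`;
* `S` is affine, `S p = L p + (β.re, β.im, 0)` with the constant linear part `L` of matrix
  `!![α.re, -(α.im η), 0; α.im, α.re η, 0; 0, 0, ‖α‖]`, so `HasFDerivWithinAt S L σ x`, and
  `det L = η ‖α‖ (α.re² + α.im²) = η ‖α‖³`, whence `|det L| = ‖α‖³` and the Jacobian identity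
  `t⁻³ = (‖α‖ t)⁻³ · |det L|`.

References: R. Benedetti, C. Petronio, *Lectures on Hyperbolic Geometry* (1992), A.3.5;
M. Kontsevich, D. Zagier, *Periods* (2001), §1.2 rule (2); J. Bochnak, M. Coste, M.-F. Roy,
*Real Algebraic Geometry* (1998), Prop. 2.2.6.
-/

noncomputable section

open Set MeasureTheory
open Literature.NumberTheory.Transcendental Literature.ModelTheory.ExponentialFields

namespace Summit.KontsevichZagierPeriods.HyperbolicBloch.IsometryMove

/-- The three coordinates of a boundary-fixing similarity `S(α, β, η)` with `α, β` algebraic and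
`η = ±1` are `ℚ`-semialgebraic functions on any `ℚ`-semialgebraic `σ`, hence `S` is a `ℚ`-semialgebraic
map there (real and imaginary parts of `α w + β` by the complex toolkit `re_im_*`; `‖α‖ t` as the norm
of an algebraic constant times a coordinate). [cite: BochnakCosteRoy1998, Prop. 2.2.6] -/
theorem simil_isSemialgebraicMapOn {α β : ℂ} {η : ℝ} (hα : IsAlgebraic ℚ α) (hβ : IsAlgebraic ℚ β)
    (hη : η = 1 ∨ η = -1) (S : (Fin 3 → ℝ) → (Fin 3 → ℝ))
    (hS : ∀ p, S p = ![(α * (Complex.mk (p 0) (η * p 1)) + β).re,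
      (α * (Complex.mk (p 0) (η * p 1)) + β).im, ‖α‖ * p 2])
    {σ : Set (Fin 3 → ℝ)} (hσ : IsSemialgebraic ℚ σ) : IsSemialgebraicMapOn ℚ σ S := by
  -- coordinates are semialgebraic
  have hcoord : ∀ i : Fin 3, IsSemialgebraicFunOn ℚ σ (fun p => p i) := fun i => by
    simpa using isSemialgebraicFunOn_aeval hσ (MvPolynomial.X i : MvPolynomial (Fin 3) ℚ)
  have hηalg : IsAlgebraic ℚ η := by
    rcases hη with rfl | rfl
    · exact isAlgebraic_one
    · exact isAlgebraic_one.neg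
  obtain ⟨hαre, hαim⟩ := isAlgebraic_re_im hα
  obtain ⟨hβre, hβim⟩ := isAlgebraic_re_im hβ
  -- the complex coordinate `w = p 0 + i η p 1`
  have hw : IsSemialgebraicFunOn ℚ σ (fun p => (Complex.mk (p 0) (η * p 1)).re) ∧
      IsSemialgebraicFunOn ℚ σ (fun p => (Complex.mk (p 0) (η * p 1)).im) :=
    ⟨hcoord 0, (IsSemialgebraicFunOn.mul_holds (isSemialgebraicFunOn_const_of_isAlgebraic hσ hηalg)
      (hcoord 1)).congr fun _ _ => rfl⟩
  -- `α w + β`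
  have hF := re_im_add (re_im_mul (re_im_const hσ hαre hαim) hw) (re_im_const hσ hβre hβim)
  -- `‖α‖ t`
  have h3 : IsSemialgebraicFunOn ℚ σ (fun p => ‖α‖ * p 2) :=
    (IsSemialgebraicFunOn.mul_holds (isSemialgebraicFunOn_norm (re_im_const hσ hαre hαim))
      (hcoord 2)).congr fun _ _ => rfl
  refine IsSemialgebraicMapOn.of_forall hσ fun j => ?_
  fin_cases j
  · exact hF.1.congr fun p _ => by simp [hS]
  · exact hF.2.congr fun p _ => by simp [hS]
  · exact h3.congr fun p _ => by simp [hS]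

/-- A boundary-fixing similarity `S(α, β, η)` with `α ≠ 0` and `η = ±1` is injective: from `S p = S q`
one reads off `α w_p + β = α w_q + β`, hence `w_p = w_q`, and `‖α‖ p₂ = ‖α‖ q₂`. [folklore] -/
theorem simil_injective {α β : ℂ} {η : ℝ} (h0 : α ≠ 0) (hη : η = 1 ∨ η = -1)
    (S : (Fin 3 → ℝ) → (Fin 3 → ℝ))
    (hS : ∀ p, S p = ![(α * (Complex.mk (p 0) (η * p 1)) + β).re,
      (α * (Complex.mk (p 0) (η * p 1)) + β).im, ‖α‖ * p 2]) :
    Function.Injective S := by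
  have hη0 : η ≠ 0 := by
    rcases hη with rfl | rfl <;> norm_num
  intro p q hpq
  have e0 : S p 0 = S q 0 := by rw [hpq]
  have e1 : S p 1 = S q 1 := by rw [hpq]
  have e2 : S p 2 = S q 2 := by rw [hpq]
  simp only [hS, Matrix.cons_val_zero, Matrix.cons_val_one, Matrix.head_cons, Matrix.cons_val_two,
    Matrix.tail_cons] at e0 e1 e2
  have hc : α * Complex.mk (p 0) (η * p 1) + β = α * Complex.mk (q 0) (η * q 1) + β :=
    Complex.ext e0 e1
  have hw : Complex.mk (p 0) (η * p 1) = Complex.mk (q 0) (η * q 1) :=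
    mul_left_cancel₀ h0 (add_right_cancel hc)
  have hp0 : p 0 = q 0 := congrArg Complex.re hw
  have hp1 : p 1 = q 1 := mul_left_cancel₀ hη0 (congrArg Complex.im hw)
  have hp2 : p 2 = q 2 := mul_left_cancel₀ (norm_ne_zero_iff.mpr h0) e2
  funext i
  fin_cases i
  exacts [hp0, hp1, hp2]

/-- A boundary-fixing similarity `S(α, β, η)` with `α ≠ 0` maps `{t > 0}` into itself
(`(S p)₂ = ‖α‖ p₂`). [folklore] -/
theorem simil_mapsTo {α β : ℂ} {η : ℝ} (h0 : α ≠ 0) (S : (Fin 3 → ℝ) → (Fin 3 → ℝ))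
    (hS : ∀ p, S p = ![(α * (Complex.mk (p 0) (η * p 1)) + β).re,
      (α * (Complex.mk (p 0) (η * p 1)) + β).im, ‖α‖ * p 2])
    {σ : Set (Fin 3 → ℝ)} (hσ : σ ⊆ {p | 0 < p 2}) : MapsTo S σ {p | 0 < p 2} := by
  intro p hp
  have hp2 : 0 < p 2 := hσ hp
  show 0 < S p 2
  simp only [hS, Matrix.cons_val_two, Matrix.tail_cons, Matrix.head_cons]
  exact mul_pos (norm_pos_iff.mpr h0) hp2

/-- A boundary-fixing similarity `S(α, β, η)` (`η = ±1`) is affine, `S p = L p + (β.re, β.im, 0)` with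
`L` the linear map of matrix `!![α.re, -(α.im η), 0; α.im, α.re η, 0; 0, 0, ‖α‖]`; hence `L` is its
Fréchet derivative everywhere and `|det L| = |η| ‖α‖ (α.re² + α.im²) = ‖α‖³`.
[cite: BenedettiPetronio1992, A.3.5] -/
theorem simil_hasFDerivAt_det {α β : ℂ} {η : ℝ} (hη : η = 1 ∨ η = -1)
    (S : (Fin 3 → ℝ) → (Fin 3 → ℝ))
    (hS : ∀ p, S p = ![(α * (Complex.mk (p 0) (η * p 1)) + β).re,
      (α * (Complex.mk (p 0) (η * p 1)) + β).im, ‖α‖ * p 2]) :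
    ∃ L : (Fin 3 → ℝ) →L[ℝ] (Fin 3 → ℝ), (∀ x, HasFDerivAt S L x) ∧ |L.det| = ‖α‖ ^ 3 := by
  set M : Matrix (Fin 3) (Fin 3) ℝ := !![α.re, -(α.im * η), 0; α.im, α.re * η, 0; 0, 0, ‖α‖] with hM
  refine ⟨LinearMap.toContinuousLinearMap (Matrix.toLin' M), fun x => ?_, ?_⟩
  · -- `S` is affine with linear part `M`
    have hSL : S = fun p => LinearMap.toContinuousLinearMap (Matrix.toLin' M) p + ![β.re, β.im, 0] := by
      funext p
      rw [hS]
      ext i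
      fin_cases i <;>
        simp [hM, Matrix.toLin'_apply, dotProduct, Fin.sum_univ_three, Complex.mul_re,
          Complex.mul_im] <;> ring
    rw [hSL]
    exact (LinearMap.toContinuousLinearMap (Matrix.toLin' M)).hasFDerivAt.add_const _
  · -- `det M = η ‖α‖³`
    have hn : α.re * α.re + α.im * α.im = ‖α‖ ^ 2 := by
      rw [Complex.sq_norm, Complex.normSq_apply]
    have hdet : M.det = η * ‖α‖ ^ 3 := by
      rw [Matrix.det_fin_three]
      simp [hM]
      linear_combination η * ‖α‖ * hn
    have hηabs : |η| = 1 := by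
      rcases hη with rfl | rfl <;> norm_num
    rw [LinearMap.det_toContinuousLinearMap, LinearMap.det_toLin', hdet, abs_mul, hηabs, one_mul,
      abs_of_nonneg (pow_nonneg (norm_nonneg α) 3)]

/-- **Similarity move data** (stub `stub_similarityMove` of line `bruhat-inversion-chain`). A
boundary-fixing similarity `S(α, β, η) : (x, y, t) ↦ (α(x + iηy) + β, ‖α‖t)` with `α ≠ 0`, `α, β`
algebraic and `η = ±1` is, on every `ℚ`-semialgebraic `σ ⊆ {t > 0}`, a `ℚ`-semialgebraic injective map
into `{t > 0}` with a derivative of determinant `±‖α‖³`, so that `t⁻³ = (S p)₃⁻³ · |det DS|`.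
[cite: BenedettiPetronio1992, A.3.5] -/
theorem stub_similarityMove : ∀ (α β : ℂ) (η : ℝ), IsAlgebraic ℚ α → IsAlgebraic ℚ β → α ≠ 0 → (η = 1 ∨ η = -1) → ∀ (S : (Fin 3 → ℝ) → (Fin 3 → ℝ)), (∀ p, S p = ![(α * (Complex.mk (p 0) (η * p 1)) + β).re, (α * (Complex.mk (p 0) (η * p 1)) + β).im, ‖α‖ * p 2]) → ∀ (σ : Set (Fin 3 → ℝ)), Literature.ModelTheory.ExponentialFields.IsSemialgebraic ℚ σ → σ ⊆ {p | 0 < p 2} → Literature.NumberTheory.Transcendental.IsSemialgebraicMapOn ℚ σ S ∧ Set.InjOn S σ ∧ Set.MapsTo S σ {p | 0 < p 2} ∧ ∃ S' : (Fin 3 → ℝ) → ((Fin 3 → ℝ) →L[ℝ] (Fin 3 → ℝ)), ∀ x ∈ σ, HasFDerivWithinAt S (S' x) σ x ∧ 1 / x 2 ^ 3 = 1 / (S x) 2 ^ 3 * |(S' x).det| := by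
  intro α β η hα hβ h0 hη S hS σ hσ hσpos
  obtain ⟨L, hL, hLdet⟩ := simil_hasFDerivAt_det hη S hS
  refine ⟨simil_isSemialgebraicMapOn hα hβ hη S hS hσ, (simil_injective h0 hη S hS).injOn,
    simil_mapsTo h0 S hS hσpos, fun _ => L, fun x hx => ⟨(hL x).hasFDerivWithinAt, ?_⟩⟩
  -- the Jacobian identity `t⁻³ = (‖α‖ t)⁻³ · ‖α‖³`
  have hx2 : S x 2 = ‖α‖ * x 2 := by
    simp only [hS, Matrix.cons_val_two, Matrix.tail_cons, Matrix.head_cons]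
  have hα0 : ‖α‖ ≠ 0 := norm_ne_zero_iff.mpr h0
  have hx0 : x 2 ≠ 0 := ne_of_gt (hσpos hx)
  rw [hLdet, hx2]
  field_simp

end Summit.KontsevichZagierPeriods.HyperbolicBloch.IsometryMove

end
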